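import Mathlib.Data.Real.Basic
import Mathlib.Tactic.Ring
import Mathlib.Tactic.Positivity
import Mathlib.Tactic.Linarith
import Mathlib.Tactic.NormNum
import Mathlib.Tactic.FieldSimp
import Mathlib.Tactic.Push
import Mathlib.Tactic.LinearCombination
import HarnessLib

/-!
# `Z(3,2)` at a three-port observer from the apex-pair row APL₁(3/10) — the degenerate strata of the certificate
# (`u3 = 0`, and `u0 = ubc = 0`)

Support file (prover seat `prim-ineq-gen-8`, gen 11; `--supports stmt-CriticalPhenomena-4575`; insurance line `Z(3,2)` =
`OneCutFive.ZeroOneThree`).  No definitions, no named facts, no sorries.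

The box certificates (`…ThreePortAplBox*`) conclude `max_v M_v ≥ 0` only where their multipliers are positive, i.e. off
`{u3 = 0} ∪ {u0 = uab = uac = ubc = 0}` (cp-lslp, `run/shared/lean/ttrl/sf3/Z32-3PORT-CERT.md` §4 (iv)).  The two strata are settled here by hand:
* `ThreePort.aplDegen_pairs` — `u0 = ubc = 0 ⟹ M_a = 0`;
* `ThreePort.aplDegen_u3` — `u3 = 0`, ports `≤ 1/2`, `Σ u = 1`, `SIG ≥ 0 ⟹ M_c ≥ 0`: with `u3 = 0`,
  `SIG = u0(α+β+γ−2) + uab(2p_ab+γ−2) + uac(2p_ac+β−2) + ubc(2p_bc+α−2)` is a sum of nonpositive terms, so `u0 = 0` and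
  `uab·(2p_ab+γ−2) = 0`, whence `M_c = uab·(p_ab − γ) = uab·(1 − 3γ/2) ≥ 0`.
(Same polynomial vocabulary as the box files, written out.)
-/

namespace Summit.CriticalPhenomena.PercolationContinuityZ3.Theorems

namespace ThreePort

/-- **Degenerate stratum `u0 = ubc = 0`**: then `M_a = 0`. [this work] -/
theorem aplDegen_pairs (u0 ubc α β γ : ℝ) (h0 : u0 = 0) (hbc : ubc = 0) : 0 ≤ ((u0 * ((1 - α) * (β * γ)) + ubc * ((1 - α) * (1 - (1 - β) * (1 - γ)))) - (u0 + ubc) * (α * ((1 - β) * (1 - γ)))) := by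
  have e : ((u0 * ((1 - α) * (β * γ)) + ubc * ((1 - α) * (1 - (1 - β) * (1 - γ)))) - (u0 + ubc) * (α * ((1 - β) * (1 - γ)))) = 0 := by rw [h0, hbc]; ring
  rw [e]

/-- **Degenerate stratum `u3 = 0`**: with ports `≤ 1/2`, `Σ u = 1` and `SIG ≥ 0`, the margin at `c` is
nonnegative. [this work] -/
theorem aplDegen_u3 (u0 uab uac ubc u3 α β γ : ℝ)
    (hu0 : 0 ≤ u0) (huab : 0 ≤ uab) (huac : 0 ≤ uac) (hubc : 0 ≤ ubc)
    (hα1 : α ≤ 1 / 2) (hβ1 : β ≤ 1 / 2) (hγ1 : γ ≤ 1 / 2)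
    (hS : 0 ≤ ((u0 * α + uab * (1 - (1 - α) * (1 - β)) + uac * (1 - (1 - α) * (1 - γ)) + ubc * α + u3 * (1 - (1 - α) * (1 - β) * (1 - γ))) + (u0 * β + uab * (1 - (1 - α) * (1 - β)) + uac * β + ubc * (1 - (1 - β) * (1 - γ)) + u3 * (1 - (1 - α) * (1 - β) * (1 - γ))) + (u0 * γ + uab * γ + uac * (1 - (1 - α) * (1 - γ)) + ubc * (1 - (1 - β) * (1 - γ)) + u3 * (1 - (1 - α) * (1 - β) * (1 - γ))) - 2 * (u0 + uab + uac + ubc + u3))) (h3 : u3 = 0) : 0 ≤ ((u0 * ((1 - γ) * (α * β)) + uab * ((1 - γ) * (1 - (1 - α) * (1 - β)))) - (u0 + uab) * (γ * ((1 - α) * (1 - β)))) := by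
  -- the four surviving coefficients are nonpositive
  have hab' : (1 - α) * (1 - β) ≥ 1 / 4 := by nlinarith
  have hac' : (1 - α) * (1 - γ) ≥ 1 / 4 := by nlinarith
  have hbc' : (1 - β) * (1 - γ) ≥ 1 / 4 := by nlinarith
  have c0 : α + β + γ - 2 ≤ -(1 / 2) := by linarith
  have cab : 2 * (1 - (1 - α) * (1 - β)) + γ - 2 ≤ 0 := by linarith
  have cac : 2 * (1 - (1 - α) * (1 - γ)) + β - 2 ≤ 0 := by linarith
  have cbc : 2 * (1 - (1 - β) * (1 - γ)) + α - 2 ≤ 0 := by linarith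
  have eS : ((u0 * α + uab * (1 - (1 - α) * (1 - β)) + uac * (1 - (1 - α) * (1 - γ)) + ubc * α + u3 * (1 - (1 - α) * (1 - β) * (1 - γ))) + (u0 * β + uab * (1 - (1 - α) * (1 - β)) + uac * β + ubc * (1 - (1 - β) * (1 - γ)) + u3 * (1 - (1 - α) * (1 - β) * (1 - γ))) + (u0 * γ + uab * γ + uac * (1 - (1 - α) * (1 - γ)) + ubc * (1 - (1 - β) * (1 - γ)) + u3 * (1 - (1 - α) * (1 - β) * (1 - γ))) - 2 * (u0 + uab + uac + ubc + u3)) = u0 * (α + β + γ - 2) + uab * (2 * (1 - (1 - α) * (1 - β)) + γ - 2) + uac * (2 * (1 - (1 - α) * (1 - γ)) + β - 2)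
      + ubc * (2 * (1 - (1 - β) * (1 - γ)) + α - 2) + u3 * (3 * (1 - (1 - α) * (1 - β) * (1 - γ)) - 2) := by ring
  have t3 : u3 * (3 * (1 - (1 - α) * (1 - β) * (1 - γ)) - 2) = 0 := by rw [h3, zero_mul]
  have t0 : u0 * (α + β + γ - 2) ≤ u0 * (-(1 / 2)) := mul_le_mul_of_nonneg_left c0 hu0
  have tab : uab * (2 * (1 - (1 - α) * (1 - β)) + γ - 2) ≤ 0 := mul_nonpos_of_nonneg_of_nonpos huab cab
  have tac : uac * (2 * (1 - (1 - α) * (1 - γ)) + β - 2) ≤ 0 := mul_nonpos_of_nonneg_of_nonpos huac cac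
  have tbc : ubc * (2 * (1 - (1 - β) * (1 - γ)) + α - 2) ≤ 0 := mul_nonpos_of_nonneg_of_nonpos hubc cbc
  have hu0' : u0 = 0 := by
    have : u0 ≤ 0 := by linarith
    linarith
  have hab0 : uab * (2 * (1 - (1 - α) * (1 - β)) + γ - 2) = 0 := by
    have t0' : u0 * (α + β + γ - 2) = 0 := by rw [hu0', zero_mul]
    have : 0 ≤ uab * (2 * (1 - (1 - α) * (1 - β)) + γ - 2) := by linarith
    linarith
  have eM : ((u0 * ((1 - γ) * (α * β)) + uab * ((1 - γ) * (1 - (1 - α) * (1 - β)))) - (u0 + uab) * (γ * ((1 - α) * (1 - β)))) = uab * (1 - 3 / 2 * γ) := by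
    linear_combination (1 / 2 : ℝ) * hab0 + ((1 - γ) * (α * β) - γ * ((1 - α) * (1 - β))) * hu0'
  rw [eM]
  exact mul_nonneg huab (by linarith)

end ThreePort

end Summit.CriticalPhenomena.PercolationContinuityZ3.Theorems
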